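import Summits.ValiantsHypothesis.ValiantsHypothesis.Theorems.GrenetZeonDualUnipotentThreeHalvesLongMassNilSpaceTraceCriterion
import Summits.ValiantsHypothesis.ValiantsHypothesis.Theorems.GrenetZeonDualUnipotentThreeHalvesLongMassTriangularTwo

/-!
# `GrenetZeon.DualUnipotentThreeHalves` (stmt-ValiantsHypothesis-24318), line `slow_core`, stub (c) `SlowCore.LongMassSlowLawInv`:
# KOLCHIN'S CRITERION — `V` is simultaneously strictly triangularisable iff the monoid generated by `1 + V` is UNIPOTENT (the Kolchin row, `c = 2`)

The native object of the dual-unipotent model (cruxes 8062 / 24318) is a UNIPOTENT affine pencil `A(x) = A(0)·(1 + L(x))`, `det A ≡ c`: every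
normalised value `1 + L(x)` is a unipotent matrix.  Kolchin's theorem (E. Kolchin 1948; Radjavi–Rosenthal, *Simultaneous Triangularization*,
Thm. 2.1.8: a multiplicative semigroup of unipotent matrices is triangularisable) therefore gives the natural GROUP-THEORETIC description of the
triangularisable locus of the (c)-menu, next to the constant basis (`∃ P`), vanishing words, the Lie envelope (Engel), vanishing word traces,
permutable trace (Radjavi) and weak closure (Jacobson):

* §1 the unipotent monoid `G(V) = {(1 + X₁)(1 + X₂)⋯(1 + X_s) : X_t ∈ V}`: closed under products (`prod_one_add_append`), its span is a
  product-closed space containing `1` and `V`, hence every `V`-word (`prod_mem_span_monoid`).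
* §2 ★★★ `conj_strictUpper_iff_monoid_unipotent` — KOLCHIN'S CRITERION for a linear space `V ≤ M_b(ℂ)`: ONE unit conjugates `V` into the strictly
  upper triangular matrices iff EVERY finite product `(1 + X₁)⋯(1 + X_s)` of members of `1 + V` is unipotent (`g − 1` nilpotent).
  (⇐) TRACE ARGUMENT: unipotent `g`, `h`, `gh` give `tr((g − 1)·h) = tr(gh) − tr(h) = b − b = 0`; by linearity `tr((g − 1)·a) = 0` on the span of
  the monoid, which contains every `V`-word; with `g = 1 + X₀` every `V`-word of positive length is traceless, and the tree's TRACE CRITERION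
  ✓ `NilSpaceEngel.conj_strictUpper_iff_trace_words_eq_zero` triangularises `V`.  (⇒) conjugates of the products are `1 +` strictly upper.
* §3 ★★ THE KOLCHIN ROW `relCert_of_valueSpace_monoid_unipotent` — an affine pencil whose values lie in a space `V` with unipotent monoid
  `G(V)` has `RelCert n m N (2·(⌊√n⌋·m))` ((c)'s conclusion, `c = 2`, `n₀ = 0`; ✓ `TriangularRow.relCert_of_valueSpace_triangularisable_two`);
  `longMass_on_monoid_unipotent_locus` in the binder shape of the stub.  VIOLATOR PORTRAIT (by name): for the value space `V` of a (c)-violator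
  some finite product `(1 + X₁)⋯(1 + X_s)`, `X_t ∈ V`, has an eigenvalue `≠ 1` — the unipotent VALUES of an expensive dual-unipotent
  representation do not generate a unipotent monoid (the smallest witness for the `3 × 3` gadget: `s = 2`).

HONEST FRAMING.  Calibration row / dictionary entry (`--supports stmt-ValiantsHypothesis-24318`), a classical structural law; NOT progress on the
research stub (c) `SlowCore.LongMassSlowLawInv`; closes no stub; S3, 24318, 8062 and `VP ≠ VNP` are NOT proved.  Def-free, no named-fact
hypotheses, no sorry.
[cite: RadjaviRosenthal2000, Thm. 2.1.8 (Kolchin's Theorem), p0035]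
-/

set_option linter.dupNamespace false
set_option autoImplicit false

noncomputable section

namespace Summit.ValiantsHypothesis.ValiantsHypothesis.Theorems.GrenetZeon.NilSpaceKolchin

open Matrix
open scoped BigOperators
open Summit.ValiantsHypothesis.ValiantsHypothesis.Cruxes.TwoDimCoefficients.DimTwoCases (AffMat IsAffine)
open Summit.ValiantsHypothesis.ValiantsHypothesis.Theorems.GrenetZeon.SlowCore (RelCert)
open Summit.ValiantsHypothesis.ValiantsHypothesis.Theorems.GrenetZeon.TriangularRow (relCert_of_valueSpace_triangularisable_two)
open Summit.ValiantsHypothesis.ValiantsHypothesis.Theorems.GrenetZeon.NilSpaceEngel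

variable {b : ℕ}

/-! ## §1 The unipotent monoid generated by `1 + V` and its span -/

/-- Products of the monoid multiply by concatenation of the letter families. -/
theorem prod_one_add_append {s₁ s₂ : ℕ} (w₁ : Fin s₁ → Matrix (Fin b) (Fin b) ℂ) (w₂ : Fin s₂ → Matrix (Fin b) (Fin b) ℂ) :
    (List.ofFn fun t => (1 : Matrix (Fin b) (Fin b) ℂ) + Fin.append w₁ w₂ t).prod =
      (List.ofFn fun t => (1 : Matrix (Fin b) (Fin b) ℂ) + w₁ t).prod * (List.ofFn fun t => (1 : Matrix (Fin b) (Fin b) ℂ) + w₂ t).prod := by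
  have h : (fun t => (1 : Matrix (Fin b) (Fin b) ℂ) + Fin.append w₁ w₂ t) =
      Fin.append (fun t => (1 : Matrix (Fin b) (Fin b) ℂ) + w₁ t) (fun t => (1 : Matrix (Fin b) (Fin b) ℂ) + w₂ t) := by
    funext t
    refine Fin.addCases (motive := fun t => (1 : Matrix (Fin b) (Fin b) ℂ) + Fin.append w₁ w₂ t =
      Fin.append (fun t => (1 : Matrix (Fin b) (Fin b) ℂ) + w₁ t) (fun t => (1 : Matrix (Fin b) (Fin b) ℂ) + w₂ t) t)
      (fun i => ?_) (fun i => ?_) t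
    · rw [Fin.append_left, Fin.append_left]
    · rw [Fin.append_right, Fin.append_right]
  rw [h, List.ofFn_fin_append, List.prod_append]

/-- **The span of the monoid is closed under products.** -/
theorem span_monoid_mul_mem (V : Submodule ℂ (Matrix (Fin b) (Fin b) ℂ)) {X Y : Matrix (Fin b) (Fin b) ℂ}
    (hX : X ∈ Submodule.span ℂ {g : Matrix (Fin b) (Fin b) ℂ | ∃ (s : ℕ) (w : Fin s → Matrix (Fin b) (Fin b) ℂ),
      (∀ t, w t ∈ V) ∧ g = (List.ofFn fun t => (1 : Matrix (Fin b) (Fin b) ℂ) + w t).prod})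
    (hY : Y ∈ Submodule.span ℂ {g : Matrix (Fin b) (Fin b) ℂ | ∃ (s : ℕ) (w : Fin s → Matrix (Fin b) (Fin b) ℂ),
      (∀ t, w t ∈ V) ∧ g = (List.ofFn fun t => (1 : Matrix (Fin b) (Fin b) ℂ) + w t).prod}) :
    X * Y ∈ Submodule.span ℂ {g : Matrix (Fin b) (Fin b) ℂ | ∃ (s : ℕ) (w : Fin s → Matrix (Fin b) (Fin b) ℂ),
      (∀ t, w t ∈ V) ∧ g = (List.ofFn fun t => (1 : Matrix (Fin b) (Fin b) ℂ) + w t).prod} := by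
  set S : Set (Matrix (Fin b) (Fin b) ℂ) := {g | ∃ (s : ℕ) (w : Fin s → Matrix (Fin b) (Fin b) ℂ),
      (∀ t, w t ∈ V) ∧ g = (List.ofFn fun t => (1 : Matrix (Fin b) (Fin b) ℂ) + w t).prod} with hS
  have hgen : ∀ u ∈ S, ∀ u' ∈ S, u * u' ∈ Submodule.span ℂ S := by
    rintro _ ⟨s₁, w₁, h₁, rfl⟩ _ ⟨s₂, w₂, h₂, rfl⟩
    exact Submodule.subset_span ⟨s₁ + s₂, Fin.append w₁ w₂, append_mem V w₁ w₂ h₁ h₂, (prod_one_add_append w₁ w₂).symm⟩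
  have hleft : ∀ u ∈ S, ∀ Y' ∈ Submodule.span ℂ S, u * Y' ∈ Submodule.span ℂ S := by
    intro u hu Y' hY'
    induction hY' using Submodule.span_induction with
    | mem y hy => exact hgen u hu y hy
    | zero => rw [Matrix.mul_zero]; exact Submodule.zero_mem _
    | add y z _ _ hy hz => rw [Matrix.mul_add]; exact Submodule.add_mem _ hy hz
    | smul a y _ hy => rw [Matrix.mul_smul]; exact Submodule.smul_mem _ a hy
  induction hX using Submodule.span_induction with
  | mem x hx => exact hleft x hx Y hY
  | zero => rw [Matrix.zero_mul]; exact Submodule.zero_mem _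
  | add x z _ _ hx hz => rw [Matrix.add_mul]; exact Submodule.add_mem _ hx hz
  | smul a x _ hx => rw [Matrix.smul_mul]; exact Submodule.smul_mem _ a hx

/-- `1` lies in the monoid (the empty product). -/
theorem one_mem_monoid (V : Submodule ℂ (Matrix (Fin b) (Fin b) ℂ)) :
    (1 : Matrix (Fin b) (Fin b) ℂ) ∈ {g : Matrix (Fin b) (Fin b) ℂ | ∃ (s : ℕ) (w : Fin s → Matrix (Fin b) (Fin b) ℂ),
      (∀ t, w t ∈ V) ∧ g = (List.ofFn fun t => (1 : Matrix (Fin b) (Fin b) ℂ) + w t).prod} :=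
  ⟨0, fun t => Fin.elim0 t, fun t => Fin.elim0 t, by rw [List.ofFn_zero, List.prod_nil]⟩

/-- `1 + X` (`X ∈ V`) lies in the monoid. -/
theorem one_add_mem_monoid (V : Submodule ℂ (Matrix (Fin b) (Fin b) ℂ)) {X : Matrix (Fin b) (Fin b) ℂ} (hX : X ∈ V) :
    (1 : Matrix (Fin b) (Fin b) ℂ) + X ∈ {g : Matrix (Fin b) (Fin b) ℂ | ∃ (s : ℕ) (w : Fin s → Matrix (Fin b) (Fin b) ℂ),
      (∀ t, w t ∈ V) ∧ g = (List.ofFn fun t => (1 : Matrix (Fin b) (Fin b) ℂ) + w t).prod} :=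
  ⟨1, fun _ => X, fun _ => hX, by rw [List.ofFn_succ, List.ofFn_zero, List.prod_cons, List.prod_nil, Matrix.mul_one]⟩

/-- **Every `V`-word lies in the span of the monoid** (`X = (1 + X) − 1`, then products). -/
theorem prod_mem_span_monoid (V : Submodule ℂ (Matrix (Fin b) (Fin b) ℂ)) :
    ∀ {s : ℕ} (w : Fin s → Matrix (Fin b) (Fin b) ℂ), (∀ t, w t ∈ V) →
      (List.ofFn w).prod ∈ Submodule.span ℂ {g : Matrix (Fin b) (Fin b) ℂ | ∃ (s : ℕ) (w : Fin s → Matrix (Fin b) (Fin b) ℂ),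
        (∀ t, w t ∈ V) ∧ g = (List.ofFn fun t => (1 : Matrix (Fin b) (Fin b) ℂ) + w t).prod}
  | 0, w, _ => by
    rw [List.ofFn_zero, List.prod_nil]
    exact Submodule.subset_span (one_mem_monoid V)
  | s + 1, w, hw => by
    rw [List.ofFn_succ, List.prod_cons]
    refine span_monoid_mul_mem V ?_ (prod_mem_span_monoid V (fun t => w t.succ) fun t => hw t.succ)
    have e : w 0 = ((1 : Matrix (Fin b) (Fin b) ℂ) + w 0) - 1 := by rw [add_sub_cancel_left]
    rw [e]
    exact Submodule.sub_mem _ (Submodule.subset_span (one_add_mem_monoid V (hw 0))) (Submodule.subset_span (one_mem_monoid V))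

/-- A unipotent matrix (`g − 1` nilpotent) has trace `b`. -/
theorem trace_eq_of_unipotent {g : Matrix (Fin b) (Fin b) ℂ} (hg : IsNilpotent (g - 1)) :
    g.trace = (Fintype.card (Fin b) : ℂ) := by
  have h0 : (g - 1).trace = 0 := (Matrix.isNilpotent_trace_of_isNilpotent hg).eq_zero
  rw [Matrix.trace_sub, Matrix.trace_one, sub_eq_zero] at h0
  exact h0

/-! ## §2 Kolchin's criterion -/

/-- Conjugates of the monoid of a strictly upper triangularisable space are `1 +` strictly upper. -/
theorem conj_prod_one_add_eq (V : Submodule ℂ (Matrix (Fin b) (Fin b) ℂ)) (P : (Matrix (Fin b) (Fin b) ℂ)ˣ)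
    (hP : ∀ A ∈ V, ∀ i j : Fin b, j ≤ i → ((P : Matrix (Fin b) (Fin b) ℂ) * A * (↑P⁻¹ : Matrix (Fin b) (Fin b) ℂ)) i j = 0) :
    ∀ {s : ℕ} (w : Fin s → Matrix (Fin b) (Fin b) ℂ), (∀ t, w t ∈ V) →
      ∃ S : Matrix (Fin b) (Fin b) ℂ, (∀ i j : Fin b, j ≤ i → S i j = 0) ∧
        (P : Matrix (Fin b) (Fin b) ℂ) * (List.ofFn fun t => (1 : Matrix (Fin b) (Fin b) ℂ) + w t).prod * (↑P⁻¹ : Matrix (Fin b) (Fin b) ℂ) =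
          1 + S
  | 0, w, _ => ⟨0, fun _ _ _ => rfl, by
      rw [List.ofFn_zero, List.prod_nil, Matrix.mul_one, Units.mul_inv, add_zero]⟩
  | s + 1, w, hw => by
    obtain ⟨S', hS', hS'eq⟩ := conj_prod_one_add_eq V P hP (fun t => w t.succ) fun t => hw t.succ
    set T : Matrix (Fin b) (Fin b) ℂ := (P : Matrix (Fin b) (Fin b) ℂ) * w 0 * (↑P⁻¹ : Matrix (Fin b) (Fin b) ℂ) with hT
    have hTsu : ∀ i j : Fin b, j ≤ i → T i j = 0 := hP (w 0) (hw 0)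
    refine ⟨T + S' + T * S', fun i j hji => ?_, ?_⟩
    · rw [Matrix.add_apply, Matrix.add_apply, hTsu i j hji, hS' i j hji, strictUpper_mul hTsu hS' i j hji, add_zero, add_zero]
    · have h1 : (P : Matrix (Fin b) (Fin b) ℂ) * (1 + w 0) * (↑P⁻¹ : Matrix (Fin b) (Fin b) ℂ) = 1 + T := by
        rw [Matrix.mul_add, Matrix.add_mul, Matrix.mul_one, Units.mul_inv]
      rw [List.ofFn_succ, List.prod_cons, ← conj_mul_conj P, hS'eq, h1]
      simp only [Matrix.add_mul, Matrix.mul_add, Matrix.one_mul, Matrix.mul_one]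
      abel

/-- ★★★ **KOLCHIN'S CRITERION.**  A linear space `V ≤ M_b(ℂ)` is simultaneously strictly upper triangularisable by ONE unit iff every finite
product `(1 + X₁)(1 + X₂)⋯(1 + X_s)` with all `X_t ∈ V` is unipotent.  (⇐) is Kolchin's theorem for the monoid generated by `1 + V`, proved by
the trace argument `tr((g − 1)h) = tr(gh) − tr h = 0` and the tree's trace criterion. [cite: RadjaviRosenthal2000, Thm. 2.1.8 (Kolchin's Theorem), p0035] -/
theorem conj_strictUpper_iff_monoid_unipotent (V : Submodule ℂ (Matrix (Fin b) (Fin b) ℂ)) :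
    (∃ P : (Matrix (Fin b) (Fin b) ℂ)ˣ, ∀ A ∈ V, ∀ i j : Fin b, j ≤ i →
        ((P : Matrix (Fin b) (Fin b) ℂ) * A * (↑P⁻¹ : Matrix (Fin b) (Fin b) ℂ)) i j = 0) ↔
      ∀ (s : ℕ) (w : Fin s → Matrix (Fin b) (Fin b) ℂ), (∀ t, w t ∈ V) →
        IsNilpotent ((List.ofFn fun t => (1 : Matrix (Fin b) (Fin b) ℂ) + w t).prod - 1) := by
  constructor
  · rintro ⟨P, hP⟩ s w hw
    obtain ⟨S, hS, hSeq⟩ := conj_prod_one_add_eq V P hP w hw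
    set g := (List.ofFn fun t => (1 : Matrix (Fin b) (Fin b) ℂ) + w t).prod with hg
    -- `P (g − 1) P⁻¹ = S` is strictly upper, hence `g − 1` is nilpotent
    have hconj : (P : Matrix (Fin b) (Fin b) ℂ) * (g - 1) * (↑P⁻¹ : Matrix (Fin b) (Fin b) ℂ) = S := by
      rw [Matrix.mul_sub, Matrix.sub_mul, hSeq, Matrix.mul_one, Units.mul_inv, add_sub_cancel_left]
    refine ⟨b, pow_eq_zero_of_conj_strictUpper P (g - 1) fun i j hji => ?_⟩
    rw [hconj]; exact hS i j hji
  · intro hU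
    set S : Set (Matrix (Fin b) (Fin b) ℂ) := {g | ∃ (s : ℕ) (w : Fin s → Matrix (Fin b) (Fin b) ℂ),
        (∀ t, w t ∈ V) ∧ g = (List.ofFn fun t => (1 : Matrix (Fin b) (Fin b) ℂ) + w t).prod} with hSdef
    -- members of the monoid are unipotent, hence have trace `b`
    have htrS : ∀ g ∈ S, g.trace = (Fintype.card (Fin b) : ℂ) := by
      rintro _ ⟨s, w, hw, rfl⟩
      exact trace_eq_of_unipotent (hU s w hw)
    have hmulS : ∀ g ∈ S, ∀ h ∈ S, g * h ∈ S := by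
      rintro _ ⟨s₁, w₁, h₁, rfl⟩ _ ⟨s₂, w₂, h₂, rfl⟩
      exact ⟨s₁ + s₂, Fin.append w₁ w₂, append_mem V w₁ w₂ h₁ h₂, (prod_one_add_append w₁ w₂).symm⟩
    -- `tr((g − 1)·a) = 0` for `g` in the monoid and `a` in its span
    have horth : ∀ g ∈ S, ∀ a ∈ Submodule.span ℂ S, ((g - 1) * a).trace = 0 := by
      intro g hg a ha
      induction ha using Submodule.span_induction with
      | mem h hh =>
        rw [Matrix.sub_mul, Matrix.one_mul, Matrix.trace_sub, htrS _ (hmulS g hg h hh), htrS h hh, sub_self]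
      | zero => rw [Matrix.mul_zero, Matrix.trace_zero]
      | add y z _ _ hy hz => rw [Matrix.mul_add, Matrix.trace_add, hy, hz, add_zero]
      | smul c y _ hy => rw [Matrix.mul_smul, Matrix.trace_smul, hy, smul_zero]
    -- every `V`-word of positive length is traceless
    refine (conj_strictUpper_iff_trace_words_eq_zero V).mpr fun s w hw => ?_
    rw [List.ofFn_succ, List.prod_cons]
    have e : w 0 = ((1 : Matrix (Fin b) (Fin b) ℂ) + w 0) - 1 := by rw [add_sub_cancel_left]
    rw [e]
    exact horth _ (one_add_mem_monoid V (hw 0)) _ (prod_mem_span_monoid V (fun t => w t.succ) fun t => hw t.succ)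

/-- ★ **Kolchin's theorem, linear-space form**: if every finite product of members of `1 + V` is unipotent, one unit conjugates `V` into the strictly
upper triangular matrices. [cite: RadjaviRosenthal2000, Thm. 2.1.8 (Kolchin's Theorem), p0035] -/
theorem exists_unit_conj_strictUpper_of_monoid_unipotent (V : Submodule ℂ (Matrix (Fin b) (Fin b) ℂ))
    (hU : ∀ (s : ℕ) (w : Fin s → Matrix (Fin b) (Fin b) ℂ), (∀ t, w t ∈ V) →
      IsNilpotent ((List.ofFn fun t => (1 : Matrix (Fin b) (Fin b) ℂ) + w t).prod - 1)) :
    ∃ P : (Matrix (Fin b) (Fin b) ℂ)ˣ, ∀ A ∈ V, ∀ i j : Fin b, j ≤ i →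
      ((P : Matrix (Fin b) (Fin b) ℂ) * A * (↑P⁻¹ : Matrix (Fin b) (Fin b) ℂ)) i j = 0 :=
  (conj_strictUpper_iff_monoid_unipotent V).mpr hU

/-- ★ **One non-unipotent product certifies wildness**: if some product `(1 + X₁)⋯(1 + X_s)`, `X_t ∈ V`, is not unipotent, NO unit conjugates `V`
into the strictly upper triangular matrices. [cite: RadjaviRosenthal2000, Thm. 2.1.8 (Kolchin's Theorem), p0035] -/
theorem not_conj_strictUpper_of_prod_not_unipotent (V : Submodule ℂ (Matrix (Fin b) (Fin b) ℂ)) {s : ℕ}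
    (w : Fin s → Matrix (Fin b) (Fin b) ℂ) (hw : ∀ t, w t ∈ V)
    (hnot : ¬ IsNilpotent ((List.ofFn fun t => (1 : Matrix (Fin b) (Fin b) ℂ) + w t).prod - 1)) :
    ¬ ∃ P : (Matrix (Fin b) (Fin b) ℂ)ˣ, ∀ A ∈ V, ∀ i j : Fin b, j ≤ i →
      ((P : Matrix (Fin b) (Fin b) ℂ) * A * (↑P⁻¹ : Matrix (Fin b) (Fin b) ℂ)) i j = 0 :=
  fun h => hnot ((conj_strictUpper_iff_monoid_unipotent V).mp h s w hw)

/-! ## §3 THE KOLCHIN ROW of the (c)-menu -/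

variable {n m : ℕ}

/-- ★★ **THE KOLCHIN ROW.**  An affine pencil `N` all of whose values lie in a linear space `V ≤ M_m(ℂ)` whose monoid `⟨1 + V⟩` is unipotent has
`RelCert n m N (2·(⌊√n⌋·m))` — (c)'s conclusion with `c = 2`, `n₀ = 0`. [cite: RadjaviRosenthal2000, Thm. 2.1.8 (Kolchin's Theorem), p0035] -/
theorem relCert_of_valueSpace_monoid_unipotent (N : AffMat n m) (hN : IsAffine N)
    (V : Submodule ℂ (Matrix (Fin m) (Fin m) ℂ)) (hV : ∀ x : Fin n × Fin n → ℂ, N.map (MvPolynomial.eval x) ∈ V)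
    (hU : ∀ (s : ℕ) (w : Fin s → Matrix (Fin m) (Fin m) ℂ), (∀ t, w t ∈ V) →
      IsNilpotent ((List.ofFn fun t => (1 : Matrix (Fin m) (Fin m) ℂ) + w t).prod - 1)) :
    RelCert n m N (2 * (Nat.sqrt n * m)) := by
  obtain ⟨P, hP⟩ := exists_unit_conj_strictUpper_of_monoid_unipotent V hU
  exact relCert_of_valueSpace_triangularisable_two N hN V hV P hP

/-- ★ **(c) ON THE KOLCHIN LOCUS**, in the binder shape of the stub `SlowCore.LongMassSlowLawInv` with `c = 2`, `n₀ = 0`: the hypotheses `B ^ b = 0` /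
`IrreducibleInv B` replaced by «the values of `B` lie in a space `V` whose monoid `⟨1 + V⟩` is unipotent» (NOT an instance of the stub).
Contrapositive = violator portrait: for the value space of a (c)-violator some product `(1 + X₁)⋯(1 + X_s)` of unipotent values has an
eigenvalue `≠ 1`. [cite: RadjaviRosenthal2000, Thm. 2.1.8 (Kolchin's Theorem), p0035] -/
theorem longMass_on_monoid_unipotent_locus :
    ∀ n b : ℕ, ∀ B : AffMat n b, IsAffine B →
      (∃ V : Submodule ℂ (Matrix (Fin b) (Fin b) ℂ), (∀ x : Fin n × Fin n → ℂ, B.map (MvPolynomial.eval x) ∈ V) ∧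
        ∀ (s : ℕ) (w : Fin s → Matrix (Fin b) (Fin b) ℂ), (∀ t, w t ∈ V) →
          IsNilpotent ((List.ofFn fun t => (1 : Matrix (Fin b) (Fin b) ℂ) + w t).prod - 1)) →
      RelCert n b B (2 * (Nat.sqrt n * b)) := by
  intro n b B hB hV
  obtain ⟨V, hV, hU⟩ := hV
  exact relCert_of_valueSpace_monoid_unipotent B hB V hV hU

end Summit.ValiantsHypothesis.ValiantsHypothesis.Theorems.GrenetZeon.NilSpaceKolchin

end
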